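import Literature.Analysis.FluidPDE.TaoCascadeCorrectedEquiv
import Literature.Analysis.FluidPDE.TaoCascadeBlowupDynamicsHolds
import HarnessLib

/-!
# Discharged schemata: Tao's Props. 6.3 / 6.4 with an arbitrary `X₃`-coefficient `γ` hold
# (Tao 2016, §6.2–6.3 — vacuously, through Thm. 6.2)

`TaoCascade.blowupDynamicsWith γ` and `TaoCascade.blowupDynamicsStepWith γ`
(`FluidPDE/TaoCascadeBlowupDynamicsWith`: Props. 6.3 and 6.4 of Tao, *Finite time blowup for an
averaged three-dimensional Navier–Stokes equation*, JAMS 29 (2016), with a general coefficient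
`γ = γ(K)` in (6.17)/(6.32); the printed statements `blowupDynamics`, `blowupDynamicsStep` are the
case `γ K = 10⁻⁵ exp(-K¹⁰)`) are stated under the contradiction hypothesis of Thm. 6.2 (a global
solution `TaoODESystem …` of the cascade ODE).  Thm. 6.2 is a theorem of the tree
(`noGlobalODESolution_holds`, `FluidPDE/TaoCascadeBlowupDynamicsHolds`), and the vacuous reductions
`blowupDynamicsWith_of_noGlobalODESolution`, `blowupDynamicsStepWith_of_noGlobalODESolution`
(`FluidPDE/TaoCascadeCorrectedEquiv`) are proved; so both schemata hold for EVERY `γ`, exactly as the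
printed instances `blowupDynamics_holds`, `blowupDynamicsStep_holds` do.  No statement is changed;
no definition, no new named fact (D-0026).

## References

* T. Tao, *Finite time blowup for an averaged three-dimensional Navier–Stokes equation*, J. Amer.
  Math. Soc. 29 (2016) 601–674: §6.2 Thm. 6.2, Prop. 6.3; §6.3 Prop. 6.4. [Tao2016AveragedNS]
-/

namespace Literature.Analysis.FluidPDE

namespace TaoCascade

/-- **Tao 2016, Prop. 6.3 with an arbitrary `X₃`-coefficient `γ` — the schema `blowupDynamicsWith γ`
holds for every `γ`** (vacuously through Thm. 6.2: `blowupDynamicsWith_of_noGlobalODESolution`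
applied to `noGlobalODESolution_holds`). [cite: Tao2016AveragedNS, §6.2 Prop. 6.3 with Thm. 6.2] -/
theorem blowupDynamicsWith_holds : ∀ γ : ℝ → ℝ, blowupDynamicsWith γ :=
  fun _ => blowupDynamicsWith_of_noGlobalODESolution noGlobalODESolution_holds

/-- **Tao 2016, Prop. 6.4 with an arbitrary `X₃`-coefficient `γ` — the schema
`blowupDynamicsStepWith γ` holds for every `γ`** (vacuously through Thm. 6.2:
`blowupDynamicsStepWith_of_noGlobalODESolution` applied to `noGlobalODESolution_holds`).
[cite: Tao2016AveragedNS, §6.3 Prop. 6.4 with Thm. 6.2] -/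
theorem blowupDynamicsStepWith_holds : ∀ γ : ℝ → ℝ, blowupDynamicsStepWith γ :=
  fun _ => blowupDynamicsStepWith_of_noGlobalODESolution noGlobalODESolution_holds

end TaoCascade

end Literature.Analysis.FluidPDE
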